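import Literature.MathematicalPhysics.QuantumFieldTheory.Chatterjee2019LargeN.MasterLoopSolutionExistence
import Literature.MathematicalPhysics.QuantumFieldTheory.LatticeGaugeDobrushin
import HarnessLib

/-!
# Chatterjee 2019, Theorem 9.2: uniqueness of the solution of the master loop equation — PROVED

S. Chatterjee, *Rigorous solution of strongly coupled `SO(N)` lattice gauge theory in the large `N` limit*,
Comm. Math. Phys. **366** (2019) 203–268 (arXiv:1502.07719), **§9, Theorem 9.2**: «Given any `L ≥ 1`, there exists
`β₀(L,d) > 0` such that if `|β| ≤ β₀(L,d)`, then there is a unique function `φ_β : 𝒮 → ℝ` such that (a) `φ_β(∅) = 1`,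
(b) `|φ_β(s)| ≤ L^{|s|}` for all `s`, and (c) `φ_β` satisfies the master loop equation of Theorem 9.1. Consequently,
there exists `β₀(d) > 0` such that for `|β| ≤ β₀(d)`, `φ_{Λ_N,N,β}(s)` converges to a limit `φ_β(s)` as `N → ∞` for every
loop sequence `s`.»  Held text: `paper:arxiv-1502.07719` (arXiv version), chunks `p0023`–`p0026` = its §9.

THEOREMS ONLY (no new `Prop`-valued definition; net Literature debt `0`).  Main results:

* ★ `masterLoopSolution_unique` — the UNIQUENESS CLAUSE of Theorem 9.2, hypothesis-free: for `L ≥ 1` there is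
  `β₀ > 0` (here `β₀ = ((48⌈L⌉²)⁵ (2(d−1)+1))⁻¹`) such that for `|β| ≤ β₀` any two functions in the solution class
  `IsMasterLoopSolution L β` (sibling module `MasterLoopEquation`) agree on every loop sequence.
* `thooftLimit_of_unsymmetrized : UnsymmetrizedMasterLoopEquation d → THooftLimit d` — the «Consequently» clause of
  Theorem 9.2 (the tree's named fact `THooftLimit`) from Theorem 8.1 ALONE (the sibling
  `MasterLoopConvergence.thooftLimit_of_unsymmetrized_of_uniqueness` took the uniqueness clause as a hypothesis).
* `masterLoopUniqueness_of_gaugeStringDuality_of_unsymmetrized` — the named fact `MasterLoopUniqueness`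
  (existence ∧ uniqueness) from Theorems 3.1 and 8.1 (existence = the trajectory sum, sibling
  `MasterLoopSolutionExistence.exists_masterLoopSolution`; a canonical exhaustion of `ℤ^d` by cubes is supplied).
* ★ `masterLoopUniqueness_of_unsymmetrized : UnsymmetrizedMasterLoopEquation d → MasterLoopUniqueness d` (v1.1) — the
  named fact from Theorem 8.1 ALONE: existence = any subsequential 't Hooft limit (class `1 ≤ L`, as in print),
  uniqueness = `masterLoopSolution_unique`; supersedes the previous item.

## The printed proof (§9, proof of Theorem 9.2) and how it is followed

Fix `β` and two solutions `φ, ψ`; `T(s) := |φ(s) − ψ(s)|`.  Degree vectors `δ(s) = (|l₁|, …, |lₙ|)`, the order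
`δ ≤ δ'` (same length, componentwise), `D(δ) := sup { T(s) : δ(s) ≤ δ }` (zero when no loop sequence qualifies),
`ι(δ) = |δ| − #δ`, `F(λ) := ∑_δ λ^{ι(δ)} D(δ)`.  Steps, in the printed order:
1. `F(λ) < ∞` for small `λ` («We claim that if `λ < (2L)^{−4/3}`, then `F(λ) < ∞`»): `D(δ) ≤ 2L^{|δ|}` by (b).
   [Deviation: instead of the binomial count of degree vectors with `|δ| = r`, `#δ = n`, we use the product structure
   `∑_{δ ∈ ℕ^{<ω}} ∏ᵢ g(δᵢ) = ∑ₙ (∑_c g(c))ⁿ` (`tsum_list_map_prod`), which needs only that every component of a genuine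
   degree vector is `≥ 2` (`two_le_length_of_isLoop`: a closed path of length one would be a self-loop) rather than
   `≥ 4`; the smallness condition becomes `4λ⌈L⌉² ≤ 1`.]
2. Subtract the master loop equations (c) of `φ` and `ψ` at the marked edge (`occ_mul_T_le`):
   `m T(s) ≤ ∑_{splittings} T(s') + |β| ∑_{deformations} T(s')` (the display after «Then by condition (c)»).
3. Bound each `T(s')` by a `D` of an explicit vector (printed bounds (tt1)–(tt3) via Lemmas 9.3, 9.5, 9.6; here
   `T_prune_two_le`, `T_prune_one_le` from the tree's length lemmas `Word.length_posSplit₁_le`, …,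
   `Word.length_negDeform_le`).  [Deviation: the printed Lemmas 9.3/9.5 also show that the two pieces of a
   splitting are NON-NULL; we do not need this — a null piece is deleted by `prune` and the result is dominated by
   `(c−k, δ₂, …)`, `(k, δ₂, …)` or `(δ₂, …)`, and these extra terms contract just as well (their index drops by
   `k`, `c−k`, `c−1 ≥ 1`).]  Summing over the second location `y ≠ x` is summing over the cyclic gap
   `k ∈ [1, c)` (`sum_gap_le`, the printed «`≤ (2/m) ∑_{x∈A₁} ∑_{k≥1} …`»; our gap is oriented, so the factor is `1`),
   whence the recursive bound `D_cons_le` — the printed «the right-hand side is an upper bound for `D(δ)`».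
4. Multiply by `λ^{ι(δ)}` and sum (printed (ff1)–(ff5), «the maps `θₖ` are injective … `ι(θₖ(δ)) = ι(δ) − 1`» etc.):
   one reindexing lemma `tsum_sum_le_tsum_of_inj` serves all six families (`tsum_F₁_le` … `tsum_F₆_le`), the images
   being parametrised additively (`(c−k, k, δ₂, …)` with `k ∈ [1,c)`) so that no truncated subtraction enters the
   injectivity.  Result (`F_le_mul_F`): `F(λ) ≤ 24λ F(λ)` once `λ ≤ 1/4` and `2(d−1)|β| ≤ λ⁵` (the printed
   `F(λ) ≤ (4λ³ + 4λ + 4|β|d λ^{−4} + 4|β|d/(1−λ)) F(λ)`, with the `λ^{−4}` absorbed into the smallness of `β`).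
5. «Since `F(λ)` is nonnegative and finite, this would imply that `F(λ) = 0`», hence `D ≡ 0`, `T ≡ 0`
   (`masterLoopSolution_unique`, with `λ = (48⌈L⌉²)⁻¹`).
All suprema and series are taken in `ℝ≥0∞` (no summability bookkeeping); the real inequality of step 2 is moved there
by `ENNReal.ofReal`.  The objects `degree`, `Dom`, `T`, `D`, `w`, `F` and the pieces `F₁`–`F₆` live in the auxiliary
namespace `MasterLoopUniquenessProof`.

## WHAT THIS IS NOT
Theorem 8.1 (the finite-`N` master loop equation, Stein's method on `SO(N)`) and Theorem 3.1 (gauge–string duality)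
remain named facts; this file proves the analytic uniqueness statement of §9 and the reductions listed above.  Nothing
here bears on four-dimensional Yang–Mills, a mass gap, or the Clay problem.

## References
* S. Chatterjee, Comm. Math. Phys. **366** (2019) 203–268, doi:10.1007/s00220-019-03353-3, arXiv:1502.07719 —
  §9: Theorem 9.1, Theorem 9.2 and its proof (Lemmas 9.3–9.8). [Chatterjee2019LargeN]
-/

noncomputable section

open scoped ENNReal
open Filter Topology
open Literature.Probability.LatticeModels Literature.MathematicalPhysics.QuantumLattice

namespace Literature.MathematicalPhysics.QuantumFieldTheory.Chatterjee2019LargeN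

variable {d : ℕ}

namespace MasterLoopUniquenessProof

/-! ### §A Generic summation lemmas in `ℝ≥0∞` -/

/-- Reindexing bound: a `tsum` of finite sums is bounded by a single `tsum` when the summands are dominated through
a map that is injective on the summation domain. [folklore] -/
private theorem tsum_sum_le_tsum_of_inj {ι κ α : Type*} (S : ι → Finset κ) (F : ι → κ → ℝ≥0∞) (g : ι → κ → α)
    (f : α → ℝ≥0∞) (hle : ∀ i, ∀ k ∈ S i, F i k ≤ f (g i k))
    (hinj : ∀ i i' k k', k ∈ S i → k' ∈ S i' → g i k = g i' k' → i = i' ∧ k = k') :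
    ∑' i, ∑ k ∈ S i, F i k ≤ ∑' a, f a := by
  calc ∑' i, ∑ k ∈ S i, F i k ≤ ∑' i, ∑ k ∈ S i, f (g i k) :=
        ENNReal.tsum_le_tsum fun i => Finset.sum_le_sum (hle i)
    _ = ∑' i, ∑' k : S i, f (g i k) := by
        refine tsum_congr fun i => ?_
        exact (Finset.tsum_subtype (S i) (fun k => f (g i k))).symm
    _ = ∑' p : (Σ i, S i), f (g p.1 p.2) := (ENNReal.tsum_sigma' (fun p : (Σ i, ↥(S i)) => f (g p.1 p.2))).symm
    _ ≤ ∑' a, f a := by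
        refine ENNReal.tsum_comp_le_tsum_of_injective (f := fun p : (Σ i, ↥(S i)) => g p.1 p.2) ?_ f
        rintro ⟨i, k, hk⟩ ⟨i', k', hk'⟩ h
        obtain ⟨rfl, rfl⟩ := hinj i i' k k' hk hk' h
        rfl

/-- `∑_{f : Fin n → ℕ} ∏ᵢ g(fᵢ) = (∑ⱼ g j)ⁿ` in `ℝ≥0∞`. [folklore] -/
private theorem tsum_pi_fin_prod (g : ℕ → ℝ≥0∞) : ∀ n : ℕ, ∑' f : Fin n → ℕ, ∏ i, g (f i) = (∑' j, g j) ^ n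
  | 0 => by
    rw [pow_zero, tsum_eq_single (default : Fin 0 → ℕ) (fun f hf => absurd (Subsingleton.elim f default) hf)]
    exact Fintype.prod_empty _
  | n + 1 => by
    rw [← (Fin.consEquiv fun _ : Fin (n + 1) => ℕ).tsum_eq]
    have h : ∀ c : ℕ × (Fin n → ℕ),
        (∏ i, g ((Fin.consEquiv (fun _ : Fin (n + 1) => ℕ) c) i)) = g c.1 * ∏ i, g (c.2 i) := by
      intro c
      rw [Fin.prod_univ_succ]
      rfl
    simp_rw [h]
    rw [ENNReal.tsum_prod', pow_succ, mul_comm]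
    simp_rw [ENNReal.tsum_mul_left, tsum_pi_fin_prod g n]
    rw [ENNReal.tsum_mul_right]

/-- `∑_{l : List ℕ} ∏ᵢ g(lᵢ) = ∑ₙ (∑ⱼ g j)ⁿ` in `ℝ≥0∞` (grading lists by length). [folklore] -/
private theorem tsum_list_map_prod (g : ℕ → ℝ≥0∞) : ∑' l : List ℕ, (l.map g).prod = ∑' n, (∑' j, g j) ^ n := by
  rw [← List.equivSigmaTuple.symm.tsum_eq]
  have h : ∀ p : (Σ n, Fin n → ℕ), ((List.equivSigmaTuple.symm p).map g).prod = ∏ i, g (p.2 i) := by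
    rintro ⟨n, f⟩
    show ((List.ofFn f).map g).prod = _
    rw [List.map_ofFn, List.prod_ofFn]
    rfl
  simp_rw [h]
  rw [ENNReal.tsum_sigma']
  exact tsum_congr fun n => tsum_pi_fin_prod g n

/-- In `ℝ≥0∞`: `a ≤ κ a` with `κ < 1` and `a` finite forces `a = 0`. [folklore] -/
private theorem eq_zero_of_le_mul {a κ : ℝ≥0∞} (h : a ≤ κ * a) (hκ : κ < 1) (ha : a ≠ ⊤) : a = 0 := by
  by_contra h0
  have h1 : a * κ < a * 1 := ENNReal.mul_lt_mul_right h0 ha hκ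
  rw [mul_one, mul_comm] at h1
  exact absurd (h.trans_lt h1) (lt_irrefl _)

/-- `∑_{j ≥ 1} t^j ≤ 2t` for `t ≤ 1/2`. [folklore] -/
private theorem tsum_geometric_succ_le {t : ℝ≥0∞} (ht : t ≤ 2⁻¹) : ∑' j : ℕ, t ^ (j + 1) ≤ 2 * t := by
  have h1 : ∑' j : ℕ, t ^ (j + 1) = t * ∑' j : ℕ, t ^ j := by
    rw [← ENNReal.tsum_mul_left]; exact tsum_congr fun j => by ring
  rw [h1, ENNReal.tsum_geometric, mul_comm]
  gcongr
  calc (1 - t)⁻¹ ≤ (1 - 2⁻¹)⁻¹ := by gcongr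
    _ = 2 := by rw [ENNReal.one_sub_inv_two, inv_inv]

/-- `j t^j ≤ (2t)^j`. [folklore] -/
private theorem mul_pow_le_two_mul_pow (t : ℝ≥0∞) (j : ℕ) : (j : ℝ≥0∞) * t ^ j ≤ (2 * t) ^ j := by
  rw [mul_pow]
  gcongr
  have : (j : ℝ≥0∞) = ((j : ℕ) : ℝ≥0∞) := rfl
  calc (j : ℝ≥0∞) ≤ ((2 ^ j : ℕ) : ℝ≥0∞) := by exact_mod_cast Nat.lt_two_pow_self.le
    _ = 2 ^ j := by push_cast; rfl


/-! ### §B Degree vectors, the suprema `D(δ)` and their a-priori bounds -/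

/-- No directed edge of `ℤ^d` is a self-loop: `v(e) ≠ u(e)`. [cite: Chatterjee2019LargeN, §2 ¶1 (directed nearest-neighbour edges)] -/
theorem tgt_ne_src (e : DEdge d) : DEdge.tgt e ≠ DEdge.src e := by
  obtain ⟨⟨x, i⟩, b⟩ := e
  have h1 : (Pi.single i (1 : ℤ) : Literature.Probability.LatticeModels.Site d) ≠ 0 := by
    intro h
    have := congr_fun h i
    simp at this
  cases b <;> simp [DEdge.tgt, DEdge.src, h1]

/-- A non-null loop has length at least two (a closed path of length one would be a self-loop).
[cite: Chatterjee2019LargeN, §2.1 (closed paths), Lemma 9.7 («The smallest non-null loop in ℤ^d is a plaquette»)] -/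
theorem two_le_length_of_isLoop {l : Word d} (hl : IsLoop l) (hne : l ≠ []) : 2 ≤ l.length := by
  match l, hl, hne with
  | [], _, hne => exact (hne rfl).elim
  | [e], hl, _ =>
    exfalso
    have h := hl.1.2 (List.cons_ne_nil e [])
    simp only [List.getLast_singleton, List.head_cons] at h
    exact tgt_ne_src e h
  | _ :: _ :: _, _, _ => simp

/-- The **degree vector** `δ(s) = (|l₁|, …, |lₙ|)` of a loop sequence. [cite: Chatterjee2019LargeN, §9, proof of Theorem 9.2 («the vector δ(s) := (δ₁, …, δₙ) will be called the degree vector of s»)] -/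
def degree (s : LoopSeq d) : List ℕ := s.map List.length

/-- `δ(∅) = ∅`. [cite: Chatterjee2019LargeN, §9, proof of Theorem 9.2 (degree vector of the null loop sequence)] -/
@[simp] theorem degree_nil : degree ([] : LoopSeq d) = [] := rfl

/-- `δ(l, l₂, …) = |l| :: δ(l₂, …)`. [cite: Chatterjee2019LargeN, §9, proof of Theorem 9.2 (degree vector)] -/
@[simp] theorem degree_cons (l : Word d) (s : LoopSeq d) : degree (l :: s) = l.length :: degree s := rfl

/-- `|s| = |δ(s)|`. [cite: Chatterjee2019LargeN, §9, proof of Theorem 9.2 («|δ| := ∑ δᵢ»)] -/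
theorem len_eq_sum_degree (s : LoopSeq d) : s.len = (degree s).sum := rfl

/-- Componentwise domination `δ ≤ δ'` of integer vectors of the same length («we will say that δ ≤ δ' if m = n and
δᵢ ≤ δ'ᵢ for each i»). [cite: Chatterjee2019LargeN, §9, proof of Theorem 9.2 (the order δ ≤ δ')] -/
abbrev Dom (δ δ' : List ℕ) : Prop := List.Forall₂ (· ≤ ·) δ δ'

/-- `|δ| ≤ |δ'|` when `δ ≤ δ'`. [cite: Chatterjee2019LargeN, §9, proof of Theorem 9.2 (the order δ ≤ δ')] -/
theorem sum_le_of_dom : ∀ {δ δ' : List ℕ}, Dom δ δ' → δ.sum ≤ δ'.sum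
  | _, _, List.Forall₂.nil => le_rfl
  | _, _, List.Forall₂.cons h t => by
    simp only [List.sum_cons]
    exact Nat.add_le_add h (sum_le_of_dom t)

/-- All components of a vector dominating the degree vector of a genuine loop sequence are `≥ 2`.
[cite: Chatterjee2019LargeN, §9, proof of Theorem 9.2 («if s is a non-null loop sequence, then δ(s) ∈ Δ⁺»)] -/
theorem two_le_of_dom_degree : ∀ {s : LoopSeq d} {δ : List ℕ}, IsLoopSeq s → Dom (degree s) δ → ∀ c ∈ δ, 2 ≤ c
  | [], δ, _, h => by
    intro c hc
    rw [degree_nil, Dom, List.forall₂_nil_left_iff] at h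
    subst h
    simp at hc
  | l :: s, [], _, h => by
    have := h.length_eq
    simp at this
  | l :: s, c :: δ, hs, h => by
    rw [degree_cons, Dom, List.forall₂_cons] at h
    intro c' hc'
    rcases List.mem_cons.mp hc' with rfl | hc'
    · exact (two_le_length_of_isLoop (hs l (by simp)).1 (hs l (by simp)).2).trans h.1
    · exact two_le_of_dom_degree (fun w hw => hs w (List.mem_cons_of_mem _ hw)) h.2 c' hc'

variable (φ ψ : LoopSeq d → ℝ)

/-- `T(s) = |φ(s) − ψ(s)|` (as an extended non-negative real). [cite: Chatterjee2019LargeN, §9, proof of Theorem 9.2 («T(s) := |φ_β(s) − ψ_β(s)|»)] -/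
def T (s : LoopSeq d) : ℝ≥0∞ := ENNReal.ofReal |φ s - ψ s|

/-- `D(δ) = sup { T(s) : s a loop sequence with δ(s) ≤ δ }` (`= 0` when no loop sequence qualifies, in particular
off `Δ⁺` and at the null sequence once `T(∅) = 0`). [cite: Chatterjee2019LargeN, §9, proof of Theorem 9.2 («D(δ) = sup_{s : δ(s) ≤ δ} T(s)»)] -/
def D (δ : List ℕ) : ℝ≥0∞ := ⨆ s : {s : LoopSeq d // IsLoopSeq s ∧ Dom (degree s) δ}, T φ ψ s.1

variable {φ ψ}

/-- `T(s) ≤ D(δ)` whenever `δ(s) ≤ δ`. [cite: Chatterjee2019LargeN, §9, proof of Theorem 9.2 (definition of D)] -/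
theorem T_le_D {s : LoopSeq d} (hs : IsLoopSeq s) {δ : List ℕ} (hδ : Dom (degree s) δ) : T φ ψ s ≤ D φ ψ δ :=
  le_iSup (fun s : {s : LoopSeq d // IsLoopSeq s ∧ Dom (degree s) δ} => T φ ψ s.1) ⟨s, hs, hδ⟩

/-- Bounding `D(δ)` by bounding every `T(s)`, `δ(s) ≤ δ`. [cite: Chatterjee2019LargeN, §9, proof of Theorem 9.2 (definition of D)] -/
theorem D_le {δ : List ℕ} {b : ℝ≥0∞} (h : ∀ s : LoopSeq d, IsLoopSeq s → Dom (degree s) δ → T φ ψ s ≤ b) :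
    D φ ψ δ ≤ b :=
  iSup_le fun s => h s.1 s.2.1 s.2.2

/-- `D(δ) = 0` if some component of `δ` is `< 2` («if δ ∈ Δ ∖ Δ⁺, let D(δ) = 0» — here automatic).
[cite: Chatterjee2019LargeN, §9, proof of Theorem 9.2 (D vanishes off Δ⁺)] -/
theorem D_eq_zero_of_lt_two {δ : List ℕ} {c : ℕ} (hc : c ∈ δ) (h2 : c < 2) : D φ ψ δ = 0 :=
  le_antisymm (D_le (d := d) fun s hs hδ => absurd (two_le_of_dom_degree hs hδ c hc) (by omega)) bot_le

/-- `D(∅) = 0` when `φ(∅) = ψ(∅)` (condition (a)). [cite: Chatterjee2019LargeN, §9, proof of Theorem 9.2 («T(∅) = 0 … D(∅) = 0»)] -/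
theorem D_nil (h : φ [] = ψ []) : D φ ψ [] = 0 := by
  refine le_antisymm (D_le fun s _ hδ => ?_) bot_le
  rw [Dom, List.forall₂_nil_right_iff, degree, List.map_eq_nil_iff] at hδ
  subst hδ
  simp [T, h]

/-- Condition (b) bounds `T`: `T(s) ≤ 2 L^{|δ|}` for `δ(s) ≤ δ`. [cite: Chatterjee2019LargeN, §9, proof of Theorem 9.2 («by the condition (b) …, D(δ) ≤ 2L^{|δ|}»)] -/
theorem T_le_two_mul_pow {L : ℝ} (hL : 1 ≤ L) (hφ : ∀ s : LoopSeq d, IsLoopSeq s → |φ s| ≤ L ^ s.len)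
    (hψ : ∀ s : LoopSeq d, IsLoopSeq s → |ψ s| ≤ L ^ s.len) {s : LoopSeq d} (hs : IsLoopSeq s) {δ : List ℕ}
    (hδ : Dom (degree s) δ) : T φ ψ s ≤ ENNReal.ofReal (2 * L ^ δ.sum) := by
  refine ENNReal.ofReal_le_ofReal ?_
  have h1 : L ^ s.len ≤ L ^ δ.sum := pow_le_pow_right₀ hL (by rw [len_eq_sum_degree]; exact sum_le_of_dom hδ)
  calc |φ s - ψ s| ≤ |φ s| + |ψ s| := abs_sub _ _
    _ ≤ L ^ s.len + L ^ s.len := add_le_add (hφ s hs) (hψ s hs)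
    _ ≤ 2 * L ^ δ.sum := by linarith

/-- Hence `D(δ) ≤ 2L^{|δ|}`. [cite: Chatterjee2019LargeN, §9, proof of Theorem 9.2 («D(δ) ≤ 2L^{|δ|} for all δ»)] -/
theorem D_le_two_mul_pow {L : ℝ} (hL : 1 ≤ L) (hφ : ∀ s : LoopSeq d, IsLoopSeq s → |φ s| ≤ L ^ s.len)
    (hψ : ∀ s : LoopSeq d, IsLoopSeq s → |ψ s| ≤ L ^ s.len) (δ : List ℕ) :
    D φ ψ δ ≤ ENNReal.ofReal (2 * L ^ δ.sum) :=
  D_le fun _ hs hδ => T_le_two_mul_pow hL hφ hψ hs hδ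

/-! ### §C The weights `λ^{ι(δ)}` and the generating function `F(λ)` -/

/-- The weight `w_t(δ) = ∏ᵢ t^{δᵢ − 1}` (`= t^{ι(δ)}`, `ι(δ) = |δ| − #δ`, on vectors with positive components).
[cite: Chatterjee2019LargeN, §9, proof of Theorem 9.2 («ι(δ) := |δ| − #δ», «F(λ) := ∑ λ^{ι(δ)} D(δ)»)] -/
def w (t : ℝ≥0∞) (δ : List ℕ) : ℝ≥0∞ := (δ.map fun c => t ^ (c - 1)).prod

/-- `w(∅) = 1`. [cite: Chatterjee2019LargeN, §9, proof of Theorem 9.2 (ι(∅) = 0)] -/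
@[simp] theorem w_nil (t : ℝ≥0∞) : w t [] = 1 := rfl

/-- `w(c :: δ) = t^{c−1} w(δ)`. [cite: Chatterjee2019LargeN, §9, proof of Theorem 9.2 (ι is additive over components)] -/
@[simp] theorem w_cons (t : ℝ≥0∞) (c : ℕ) (δ : List ℕ) : w t (c :: δ) = t ^ (c - 1) * w t δ := by
  simp [w]

variable (φ ψ)

/-- The generating function `F(λ) = ∑_δ λ^{ι(δ)} D(δ)` (sum over all integer vectors; the terms off `Δ⁺` vanish).
[cite: Chatterjee2019LargeN, §9, proof of Theorem 9.2 («F(λ) := ∑_{δ∈Δ⁺} λ^{ι(δ)} D(δ) = ∑_{δ∈Δ} λ^{ι(δ)} D(δ)»)] -/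
def F (t : ℝ≥0∞) : ℝ≥0∞ := ∑' δ : List ℕ, w t δ * D φ ψ δ

variable {φ ψ}

/-- `∏ᵢ M^{δᵢ} = M^{|δ|}`. [folklore] -/
private theorem prod_map_pow (M : ℝ≥0∞) : ∀ δ : List ℕ, (δ.map fun c => M ^ c).prod = M ^ δ.sum
  | [] => by simp
  | c :: δ => by rw [List.map_cons, List.prod_cons, List.sum_cons, pow_add, prod_map_pow M δ]

/-- A product of indicators vanishes as soon as one factor does. [folklore] -/
private theorem prod_map_ite_eq_zero {δ : List ℕ} {c : ℕ} (hc : c ∈ δ) (h2 : c < 2) (g : ℕ → ℝ≥0∞) :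
    (δ.map fun c => if 2 ≤ c then g c else 0).prod = 0 := by
  rw [List.prod_eq_zero_iff]
  exact List.mem_map.mpr ⟨c, hc, by rw [if_neg (by omega)]⟩

/-- Off the vanishing set the indicator product is the plain product. [folklore] -/
private theorem prod_map_ite_eq {δ : List ℕ} (h : ∀ c ∈ δ, 2 ≤ c) (g : ℕ → ℝ≥0∞) :
    (δ.map fun c => if 2 ≤ c then g c else 0).prod = (δ.map g).prod := by
  rw [List.map_congr_left (fun c hc => if_pos (h c hc))]

/-- **`F(λ) < ∞` for small `λ`** («if `λ < (2L)^{-4/3}`, then `F(λ) < ∞`»; here: `4 t M² ≤ 1` with `L ≤ M`, via the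
product structure `∑_δ ∏ᵢ g(δᵢ) = ∑ₙ (∑_c g c)ⁿ` instead of the printed binomial count).
[cite: Chatterjee2019LargeN, §9, proof of Theorem 9.2 («We claim that if λ < (2L)^{-4/3}, then F(λ) < ∞»)] -/
theorem F_lt_top {L : ℝ} (hL : 1 ≤ L) (hφ : ∀ s : LoopSeq d, IsLoopSeq s → |φ s| ≤ L ^ s.len)
    (hψ : ∀ s : LoopSeq d, IsLoopSeq s → |ψ s| ≤ L ^ s.len) {M : ℕ} (hLM : L ≤ M) {t : ℝ≥0∞}
    (htM : 4 * t * (M : ℝ≥0∞) ^ 2 ≤ 1) : F φ ψ t < ⊤ := by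
  -- the single-component majorant
  set g : ℕ → ℝ≥0∞ := fun c => t ^ (c - 1) * if 2 ≤ c then (M : ℝ≥0∞) ^ c else 0 with hg
  have hL0 : 0 ≤ L := zero_le_one.trans hL
  -- termwise bound `w(δ) D(δ) ≤ 2 ∏ g(δᵢ)`
  have hterm : ∀ δ : List ℕ, w t δ * D φ ψ δ ≤ 2 * (δ.map g).prod := by
    intro δ
    have hsplit : (δ.map g).prod = w t δ * (δ.map fun c => if 2 ≤ c then (M : ℝ≥0∞) ^ c else 0).prod := by
      rw [w, ← List.prod_map_mul]
    rw [hsplit, mul_left_comm]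
    gcongr
    by_cases hδ : ∀ c ∈ δ, 2 ≤ c
    · rw [prod_map_ite_eq hδ, prod_map_pow]
      refine (D_le_two_mul_pow hL hφ hψ δ).trans ?_
      rw [ENNReal.ofReal_mul zero_le_two, ENNReal.ofReal_ofNat, ENNReal.ofReal_pow hL0]
      gcongr
      rw [← ENNReal.ofReal_natCast]
      exact ENNReal.ofReal_le_ofReal hLM
    · push Not at hδ
      obtain ⟨c, hc, h2⟩ := hδ
      rw [D_eq_zero_of_lt_two hc h2, prod_map_ite_eq_zero hc h2]
      simp
  -- the single-component sum `G = ∑_c g c = t M² ∑ⱼ (tM)ʲ ≤ 1/2`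
  have htM2 : t * (M : ℝ≥0∞) ^ 2 ≤ 4⁻¹ := by
    rw [ENNReal.le_inv_iff_mul_le]
    calc t * (M : ℝ≥0∞) ^ 2 * 4 = 4 * t * (M : ℝ≥0∞) ^ 2 := by ring
      _ ≤ 1 := htM
  have htM' : t * M ≤ 2⁻¹ := by
    rcases Nat.eq_zero_or_pos M with hM | hM
    · simp [hM]
    · have hM' : (1 : ℝ≥0∞) ≤ M := by exact_mod_cast hM
      rw [ENNReal.le_inv_iff_mul_le]
      calc t * M * 2 ≤ t * M * 4 := by gcongr; norm_num
        _ = t * (M * 1) * 4 := by rw [mul_one]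
        _ ≤ t * (M * M) * 4 := by gcongr
        _ = 4 * t * (M : ℝ≥0∞) ^ 2 := by ring
        _ ≤ 1 := htM
  have hG : ∑' c, g c ≤ 2⁻¹ := by
    have hsupp : Function.support g ⊆ Set.range fun j : ℕ => j + 2 := by
      intro c hc
      rw [Function.mem_support] at hc
      by_cases h2c : 2 ≤ c
      · exact ⟨c - 2, by simp [Nat.sub_add_cancel h2c]⟩
      · exact absurd (by simp [hg, h2c]) hc
    have hinj : Function.Injective fun j : ℕ => j + 2 := fun a b h => by simpa using h
    rw [← hinj.tsum_eq hsupp]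
    have h2 : ∀ j : ℕ, g (j + 2) = t * (M : ℝ≥0∞) ^ 2 * (t * M) ^ j := by
      intro j
      simp only [hg, show 2 ≤ j + 2 by omega, if_true, show j + 2 - 1 = j + 1 by omega]
      ring
    simp_rw [h2]
    rw [ENNReal.tsum_mul_left, ENNReal.tsum_geometric]
    have hinv : (1 - t * (M : ℝ≥0∞))⁻¹ ≤ 2 :=
      calc (1 - t * (M : ℝ≥0∞))⁻¹ ≤ (1 - 2⁻¹)⁻¹ := by gcongr
        _ = 2 := by rw [ENNReal.one_sub_inv_two, inv_inv]
    rw [ENNReal.le_inv_iff_mul_le]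
    calc t * (M : ℝ≥0∞) ^ 2 * (1 - t * M)⁻¹ * 2 ≤ t * (M : ℝ≥0∞) ^ 2 * 2 * 2 := by gcongr
      _ = 4 * t * (M : ℝ≥0∞) ^ 2 := by ring
      _ ≤ 1 := htM
  -- sum over all vectors
  calc F φ ψ t ≤ ∑' δ : List ℕ, 2 * (δ.map g).prod := ENNReal.tsum_le_tsum hterm
    _ = 2 * ∑' n : ℕ, (∑' c, g c) ^ n := by rw [ENNReal.tsum_mul_left, tsum_list_map_prod]
    _ ≤ 2 * ∑' n : ℕ, (2⁻¹ : ℝ≥0∞) ^ n := by gcongr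
    _ = 2 * 2 := by rw [ENNReal.tsum_geometric, ENNReal.one_sub_inv_two, inv_inv]
    _ < ⊤ := by norm_num


/-! ### §D The pointwise estimate: condition (c) for `φ` and `ψ`, subtracted -/

/-- The splitting term is linear in the evaluation. [cite: Chatterjee2019LargeN, Theorem 9.1 (splitting term)] -/
theorem splitTermAt_sub (F G : LoopSeq d → ℝ) (l : Word d) (rest : LoopSeq d) (e : DEdge d) :
    splitTermAt (fun s => F s - G s) l rest e = splitTermAt F l rest e - splitTermAt G l rest e := by
  simp only [splitTermAt, Finset.sum_sub_distrib]
  ring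

/-- The deformation term is linear in the evaluation. [cite: Chatterjee2019LargeN, Theorem 9.1 (deformation term)] -/
theorem deformTermAt_sub (F G : LoopSeq d → ℝ) (l : Word d) (rest : LoopSeq d) (e : DEdge d) :
    deformTermAt (fun s => F s - G s) l rest e = deformTermAt F l rest e - deformTermAt G l rest e := by
  simp only [deformTermAt, Finset.sum_sub_distrib]
  ring

/-- `prune (a :: L)` deletes `a` iff it is null. [cite: Chatterjee2019LargeN, §2.1 (minimal representation)] -/
theorem prune_cons (a : Word d) (L : LoopSeq d) :
    LoopSeq.prune (a :: L) = if a = [] then LoopSeq.prune L else a :: LoopSeq.prune L := by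
  by_cases h : a = [] <;> simp [LoopSeq.prune, h]

/-- **Subtracting the master loop equations of `φ` and `ψ`** (condition (c)) at the marked edge `e = l[x₀]`:
`m T(s) ≤ ∑_{splittings} T(s') + |β| ∑_{deformations} T(s')` (the inequality displayed after «Then by condition (c)»).
[cite: Chatterjee2019LargeN, §9, proof of Theorem 9.2 (the bound on T(s) from condition (c))] -/
theorem occ_mul_T_le {β : ℝ} (hφc : SatisfiesMasterLoopEquation φ β) (hψc : SatisfiesMasterLoopEquation ψ β)
    {l : Word d} {rest : LoopSeq d} (hs : IsLoopSeq (l :: rest)) (x₀ : Fin l.length) :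
    (Word.occ l (l.get x₀) : ℝ≥0∞) * T φ ψ (l :: rest) ≤
      ((∑ xy ∈ Word.invPairs l (l.get x₀),
          T φ ψ (LoopSeq.prune (Word.negSplit₁ l xy.1 xy.2 :: Word.negSplit₂ l xy.1 xy.2 :: rest)))
        + ∑ xy ∈ Word.samePairs l (l.get x₀),
          T φ ψ (LoopSeq.prune (Word.posSplit₁ l xy.1 xy.2 :: Word.posSplit₂ l xy.1 xy.2 :: rest)))
      + ENNReal.ofReal |β| *
        ((∑ p ∈ plaquettesAt (l.get x₀), ∑ x ∈ Word.locs l (l.get x₀),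
            T φ ψ (LoopSeq.prune (Word.negDeform l x p :: rest)))
          + ∑ p ∈ plaquettesAt (l.get x₀), ∑ x ∈ Word.locs l (l.get x₀),
            T φ ψ (LoopSeq.prune (Word.posDeform l x p :: rest))) := by
  set e := l.get x₀ with he
  set G : LoopSeq d → ℝ := fun s' => φ (LoopSeq.prune s') - ψ (LoopSeq.prune s') with hG
  have h1 := hφc l rest hs x₀
  have h2 := hψc l rest hs x₀
  rw [← he] at h1 h2
  have hdiff : (Word.occ l e : ℝ) * (φ (l :: rest) - ψ (l :: rest)) =
      splitTermAt G l rest e + β * deformTermAt G l rest e := by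
    rw [mul_sub, h1, h2, hG, splitTermAt_sub, deformTermAt_sub]
    ring
  -- the real inequality
  have key : (Word.occ l e : ℝ) * |φ (l :: rest) - ψ (l :: rest)| ≤
      ((∑ xy ∈ Word.invPairs l e, |G (Word.negSplit₁ l xy.1 xy.2 :: Word.negSplit₂ l xy.1 xy.2 :: rest)|)
        + ∑ xy ∈ Word.samePairs l e, |G (Word.posSplit₁ l xy.1 xy.2 :: Word.posSplit₂ l xy.1 xy.2 :: rest)|)
      + |β| * ((∑ p ∈ plaquettesAt e, ∑ x ∈ Word.locs l e, |G (Word.negDeform l x p :: rest)|)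
        + ∑ p ∈ plaquettesAt e, ∑ x ∈ Word.locs l e, |G (Word.posDeform l x p :: rest)|) := by
    rw [← abs_of_nonneg (Nat.cast_nonneg (α := ℝ) (Word.occ l e)), ← abs_mul, hdiff]
    refine (abs_add_le _ _).trans (add_le_add ?_ ?_)
    · rw [splitTermAt]
      exact (abs_sub _ _).trans (add_le_add (Finset.abs_sum_le_sum_abs _ _) (Finset.abs_sum_le_sum_abs _ _))
    · rw [abs_mul]
      refine mul_le_mul_of_nonneg_left ?_ (abs_nonneg β)
      rw [deformTermAt]
      refine (abs_sub _ _).trans (add_le_add ?_ ?_) <;>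
        exact (Finset.abs_sum_le_sum_abs _ _).trans (Finset.sum_le_sum fun p _ => Finset.abs_sum_le_sum_abs _ _)
  -- transfer to `ℝ≥0∞`
  have hT : ∀ s' : LoopSeq d, ENNReal.ofReal |G s'| = T φ ψ (LoopSeq.prune s') := fun s' => rfl
  calc (Word.occ l e : ℝ≥0∞) * T φ ψ (l :: rest)
        = ENNReal.ofReal ((Word.occ l e : ℝ) * |φ (l :: rest) - ψ (l :: rest)|) := by
          rw [T, ENNReal.ofReal_mul (Nat.cast_nonneg _), ENNReal.ofReal_natCast]
    _ ≤ _ := ENNReal.ofReal_le_ofReal key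
    _ = _ := by
          rw [ENNReal.ofReal_add (by positivity) (by positivity), ENNReal.ofReal_add (by positivity) (by positivity),
            ENNReal.ofReal_mul (abs_nonneg β), ENNReal.ofReal_add (by positivity) (by positivity),
            ENNReal.ofReal_sum_of_nonneg (fun _ _ => abs_nonneg _),
            ENNReal.ofReal_sum_of_nonneg (fun _ _ => abs_nonneg _),
            ENNReal.ofReal_sum_of_nonneg (fun _ _ => Finset.sum_nonneg fun _ _ => abs_nonneg _),
            ENNReal.ofReal_sum_of_nonneg (fun _ _ => Finset.sum_nonneg fun _ _ => abs_nonneg _)]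
          simp_rw [ENNReal.ofReal_sum_of_nonneg (fun _ _ => abs_nonneg _), hT]

/-! ### §E Degree bookkeeping of the results of the operations (Lemmas 9.3, 9.5, 9.6 in inequality form) -/

/-- A splitting result: after deleting null pieces, `(×¹, ×², l₂, …)` with `|×¹| ≤ c − k`, `|×²| ≤ k` is dominated by one
of `(c−k, k, δ₂, …)`, `(c−k, δ₂, …)`, `(k, δ₂, …)`, `(δ₂, …)` — so `T` of it is at most the sum of the four `D`'s.
(The printed Lemmas 9.3/9.5 show the pieces are non-null; the two extra cases cost nothing below.)
[cite: Chatterjee2019LargeN, Lemma 9.3, Lemma 9.5, and §9 proof of Theorem 9.2 (bounds (tt1)–(tt2))] -/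
theorem T_prune_two_le {a b : Word d} {rest : LoopSeq d} (ha : IsLoop a) (hb : IsLoop b) (hrest : IsLoopSeq rest)
    {δr : List ℕ} (hδ : Dom (degree rest) δr) {c k : ℕ} (hak : a.length ≤ c - k) (hbk : b.length ≤ k) :
    T φ ψ (LoopSeq.prune (a :: b :: rest)) ≤
      D φ ψ ((c - k) :: k :: δr) + D φ ψ ((c - k) :: δr) + D φ ψ (k :: δr) + D φ ψ δr := by
  have hpr : LoopSeq.prune rest = rest := LoopSeq.prune_eq_self fun l hl => (hrest l hl).2
  have hcons : ∀ {w : Word d} {L : LoopSeq d}, IsLoop w → w ≠ [] → IsLoopSeq L → IsLoopSeq (w :: L) := by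
    intro w L hw hw0 hL u hu
    rcases List.mem_cons.mp hu with rfl | hu
    · exact ⟨hw, hw0⟩
    · exact hL u hu
  rw [prune_cons, prune_cons, hpr]
  by_cases ha0 : a = [] <;> by_cases hb0 : b = [] <;> simp only [ha0, hb0, if_true, if_false]
  · exact le_add_left (T_le_D hrest hδ)
  · exact le_add_right (le_add_left (T_le_D (hcons hb hb0 hrest) (List.Forall₂.cons hbk hδ)))
  · exact le_add_right (le_add_right (le_add_left (T_le_D (hcons ha ha0 hrest) (List.Forall₂.cons hak hδ))))
  · exact le_add_right (le_add_right (le_add_right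
      (T_le_D (hcons ha ha0 (hcons hb hb0 hrest)) (List.Forall₂.cons hak (List.Forall₂.cons hbk hδ)))))

/-- A deformation result `(l ⊖ₓ p, l₂, …)` or `(l ⊕ₓ p, l₂, …)` with `|l ⊖ₓ p| ≤ c + 4` is dominated by `(c+4, δ₂, …)` or,
if the new loop is null, by `(δ₂, …)`. [cite: Chatterjee2019LargeN, Lemma 9.6, and §9 proof of Theorem 9.2 (bound (tt3))] -/
theorem T_prune_one_le {a : Word d} {rest : LoopSeq d} (ha : IsLoop a) (hrest : IsLoopSeq rest) {δr : List ℕ}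
    (hδ : Dom (degree rest) δr) {c : ℕ} (hac : a.length ≤ c + 4) :
    T φ ψ (LoopSeq.prune (a :: rest)) ≤ D φ ψ ((c + 4) :: δr) + D φ ψ δr := by
  have hpr : LoopSeq.prune rest = rest := LoopSeq.prune_eq_self fun l hl => (hrest l hl).2
  rw [prune_cons, hpr]
  by_cases ha0 : a = [] <;> simp only [ha0, if_true, if_false]
  · exact le_add_left (T_le_D hrest hδ)
  · refine le_add_right (T_le_D (fun u hu => ?_) (List.Forall₂.cons hac hδ))
    rcases List.mem_cons.mp hu with rfl | hu
    · exact ⟨ha, ha0⟩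
    · exact hrest u hu

/-! ### §F Reindexing the splitting sums by the cyclic gap -/

/-- The cyclic gap in coordinates. [cite: Chatterjee2019LargeN, §2.1 (locations in a cycle)] -/
theorem gap_eq_ite (l : Word d) (x y : Fin l.length) :
    Word.gap l x y = if (x : ℕ) ≤ y then (y : ℕ) - x else l.length + y - x := by
  unfold Word.gap
  split_ifs with h
  · exact Fin.coe_sub_iff_le.mpr h
  · exact Fin.coe_sub_iff_lt.mpr (lt_of_not_ge h)

/-- For fixed `x`, `y ↦ gap(x, y)` is injective. [cite: Chatterjee2019LargeN, §2.1 (locations in a cycle)] -/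
theorem gap_injective (l : Word d) (x : Fin l.length) : Function.Injective (Word.gap l x) := by
  intro y y' h
  rw [gap_eq_ite, gap_eq_ite] at h
  have hy := y.isLt
  have hy' := y'.isLt
  apply Fin.ext
  split_ifs at h <;> omega

/-- The sum over the second location `y ≠ x` of a function of the gap is a sum over gaps `k ∈ [1, c)` (`|l| ≤ c`).
[cite: Chatterjee2019LargeN, §9, proof of Theorem 9.2 («∑_{y∈A₁∖{x}} D(δ₁ − |y−x|, |y−x|, …) ≤ 2 ∑_{k≥1} D(δ₁−k, k, …)»)] -/
theorem sum_gap_le (l : Word d) (x : Fin l.length) {c : ℕ} (hc : l.length ≤ c) (f : ℕ → ℝ≥0∞) :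
    ∑ y ∈ Finset.univ.filter (fun y => x ≠ y), f (Word.gap l x y) ≤ ∑ k ∈ Finset.Ico 1 c, f k := by
  rw [← Finset.sum_image (g := Word.gap l x) (f := f) fun y _ y' _ h => gap_injective l x h]
  refine Finset.sum_le_sum_of_subset fun k hk => ?_
  rw [Finset.mem_image] at hk
  obtain ⟨y, hy, rfl⟩ := hk
  rw [Finset.mem_filter] at hy
  rw [Finset.mem_Ico]
  exact ⟨Word.gap_pos l hy.2, (Word.gap_lt l x y).trans_le hc⟩

/-- Pairs of the two splitting index sets have their first location in `C₁` and distinct locations.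
[cite: Chatterjee2019LargeN, Theorem 8.1 (the index sets of the splitting term)] -/
theorem samePairs_subset (l : Word d) (e : DEdge d) :
    Word.samePairs l e ⊆ (Word.locs l e ×ˢ Finset.univ).filter fun xy => xy.1 ≠ xy.2 := by
  intro xy h
  rw [Word.samePairs, Finset.mem_filter] at h
  rw [Finset.mem_filter, Finset.mem_product, Word.locs, Finset.mem_filter]
  exact ⟨⟨⟨Finset.mem_univ _, h.2.2.2⟩, Finset.mem_univ _⟩, h.2.1⟩

/-- Same for the inverse pairs. [cite: Chatterjee2019LargeN, Theorem 8.1 (the index sets of the splitting term)] -/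
theorem invPairs_subset (l : Word d) (e : DEdge d) :
    Word.invPairs l e ⊆ (Word.locs l e ×ˢ Finset.univ).filter fun xy => xy.1 ≠ xy.2 := by
  intro xy h
  rw [Word.invPairs, Finset.mem_filter] at h
  rw [Finset.mem_filter, Finset.mem_product, Word.locs, Finset.mem_filter]
  have hne : xy.1 ≠ xy.2 := by
    rintro heq
    rcases h.2 with ⟨h1, h2⟩ | ⟨h1, h2⟩
    · rw [heq] at h1; rw [h1] at h2; exact DEdge.inv_ne_self e h2.symm
    · rw [heq] at h1; rw [h1] at h2; exact DEdge.inv_ne_self e h2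
  rcases h.2 with ⟨h1, -⟩ | ⟨h1, -⟩
  · exact ⟨⟨⟨Finset.mem_univ _, Or.inl h1⟩, Finset.mem_univ _⟩, hne⟩
  · exact ⟨⟨⟨Finset.mem_univ _, Or.inr h1⟩, Finset.mem_univ _⟩, hne⟩

/-- A sum over a family of location pairs `(x, y)`, `x ∈ C₁`, `y ≠ x`, of a function of the gap is at most
`m ∑_{k∈[1,c)}`. [cite: Chatterjee2019LargeN, §9, proof of Theorem 9.2 («(2/m) ∑_{x∈A₁} ∑_{k≥1} … ≤ 2 ∑_{k≥1} …»)] -/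
theorem sum_pairs_le {l : Word d} {e : DEdge d} {P : Finset (Fin l.length × Fin l.length)}
    (hP : P ⊆ (Word.locs l e ×ˢ Finset.univ).filter fun xy => xy.1 ≠ xy.2) {c : ℕ} (hc : l.length ≤ c)
    (G : Fin l.length × Fin l.length → ℝ≥0∞) (f : ℕ → ℝ≥0∞) (hG : ∀ xy ∈ P, G xy ≤ f (Word.gap l xy.1 xy.2)) :
    ∑ xy ∈ P, G xy ≤ (Word.occ l e : ℝ≥0∞) * ∑ k ∈ Finset.Ico 1 c, f k := by
  calc ∑ xy ∈ P, G xy ≤ ∑ xy ∈ P, f (Word.gap l xy.1 xy.2) := Finset.sum_le_sum hG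
    _ ≤ ∑ xy ∈ (Word.locs l e ×ˢ Finset.univ).filter (fun xy => xy.1 ≠ xy.2), f (Word.gap l xy.1 xy.2) :=
        Finset.sum_le_sum_of_subset hP
    _ = ∑ x ∈ Word.locs l e, ∑ y ∈ Finset.univ.filter (fun y => x ≠ y), f (Word.gap l x y) := by
        rw [Finset.sum_filter, Finset.sum_product]
        refine Finset.sum_congr rfl fun x _ => ?_
        rw [Finset.sum_filter]
    _ ≤ ∑ x ∈ Word.locs l e, ∑ k ∈ Finset.Ico 1 c, f k := Finset.sum_le_sum fun x _ => sum_gap_le l x hc f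
    _ = (Word.occ l e : ℝ≥0∞) * ∑ k ∈ Finset.Ico 1 c, f k := by
        rw [Finset.sum_const, nsmul_eq_mul, Word.occ]


/-! ### §G The recursive bound on `D` («the right-hand side is an upper bound for D(δ)») -/

/-- `|𝒫⁺(e)| ≤ 2(d−1)`. [cite: Chatterjee2019LargeN, §2.2 (the set 𝒫⁺(e)), §9 proof of Theorem 9.2 («|𝒫⁺(e)| ≤ 2(d−1)»)] -/
theorem card_plaquettesAt_le (e : DEdge d) : (plaquettesAt e).card ≤ 2 * (d - 1) :=
  card_plaquettesTouching_singleton_le e.1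

/-- **The recursive bound.** For every integer vector `(c, δ₂, …, δₙ)`:
`D(c, δ₂, …) ≤ 2 ∑_{1 ≤ k < c} [D(c−k, k, δ₂, …) + D(c−k, δ₂, …) + D(k, δ₂, …) + D(δ₂, …)]
 + 2·(2(d−1))·|β|·[D(c+4, δ₂, …) + D(δ₂, …)]` — the printed
`T(s) ≤ 4∑ₖ D(θₖ(δ)) + 4∑ₖ D(ηₖ(δ)) + 4|β|d D(α(δ)) + 4|β|d D(γ(δ))` with the two splitting families merged, the null-piece
cases kept, and the supremum over `s` taken. [cite: Chatterjee2019LargeN, §9, proof of Theorem 9.2 («Since this bound holds for every non-null s such that δ(s) ≤ δ, therefore the right-hand side is an upper bound for D(δ)»)] -/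
theorem D_cons_le {β : ℝ} (hφc : SatisfiesMasterLoopEquation φ β) (hψc : SatisfiesMasterLoopEquation ψ β)
    (c : ℕ) (δr : List ℕ) :
    D φ ψ (c :: δr) ≤
      2 * (∑ k ∈ Finset.Ico 1 c,
          (D φ ψ ((c - k) :: k :: δr) + D φ ψ ((c - k) :: δr) + D φ ψ (k :: δr) + D φ ψ δr))
        + 2 * ((2 * (d - 1) : ℕ) : ℝ≥0∞) * ENNReal.ofReal |β| * (D φ ψ ((c + 4) :: δr) + D φ ψ δr) := by
  refine D_le fun s hs hδ => ?_
  -- the loop sequence is `l :: rest` with `|l| ≤ c`, `δ(rest) ≤ δr`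
  match s, hs, hδ with
  | [], _, hδ => exact absurd hδ.length_eq (by simp)
  | l :: rest, hs, hδ =>
    rw [degree_cons, Dom, List.forall₂_cons] at hδ
    obtain ⟨hlc, hδ⟩ := hδ
    have hl : IsLoop l ∧ l ≠ [] := hs l (by simp)
    have hrest : IsLoopSeq rest := fun u hu => hs u (List.mem_cons_of_mem _ hu)
    have hn : 0 < l.length := List.length_pos_of_ne_nil hl.2
    set x₀ : Fin l.length := ⟨0, hn⟩ with hx₀
    set e := l.get x₀ with he
    set f : ℕ → ℝ≥0∞ := fun k =>
      D φ ψ ((c - k) :: k :: δr) + D φ ψ ((c - k) :: δr) + D φ ψ (k :: δr) + D φ ψ δr with hf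
    set X : ℝ≥0∞ := D φ ψ ((c + 4) :: δr) + D φ ψ δr with hX
    -- `m ≥ 1`
    have hx₀mem : x₀ ∈ Word.locs l e := by
      rw [Word.locs, Finset.mem_filter]; exact ⟨Finset.mem_univ _, Or.inl rfl⟩
    have hm0 : (Word.occ l e : ℝ≥0∞) ≠ 0 := by
      have : 0 < Word.occ l e := Finset.card_pos.mpr ⟨x₀, hx₀mem⟩
      exact_mod_cast this.ne'
    -- the two splitting sums
    have hS₁ : ∑ xy ∈ Word.invPairs l e,
        T φ ψ (LoopSeq.prune (Word.negSplit₁ l xy.1 xy.2 :: Word.negSplit₂ l xy.1 xy.2 :: rest)) ≤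
        (Word.occ l e : ℝ≥0∞) * ∑ k ∈ Finset.Ico 1 c, f k := by
      refine sum_pairs_le (invPairs_subset l e) hlc _ f fun xy hxy => ?_
      have hinv := Word.get_eq_of_mem_invPairs hxy
      have hg := Word.gap_lt l xy.1 xy.2
      exact T_prune_two_le (Word.isLoop_negSplit₁ hl.1.1 hinv) (Word.isLoop_negSplit₂ hl.1.1 hinv) hrest hδ
        ((Word.length_negSplit₁_le l xy.1 xy.2).trans (by omega))
        ((Word.length_negSplit₂_le l xy.1 xy.2).trans (by omega))
    have hS₂ : ∑ xy ∈ Word.samePairs l e,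
        T φ ψ (LoopSeq.prune (Word.posSplit₁ l xy.1 xy.2 :: Word.posSplit₂ l xy.1 xy.2 :: rest)) ≤
        (Word.occ l e : ℝ≥0∞) * ∑ k ∈ Finset.Ico 1 c, f k := by
      refine sum_pairs_le (samePairs_subset l e) hlc _ f fun xy hxy => ?_
      obtain ⟨hne, hsame⟩ := Word.get_eq_of_mem_samePairs hxy
      have hg := Word.gap_lt l xy.1 xy.2
      exact T_prune_two_le (Word.isLoop_posSplit₁ hl.1.1 hne hsame) (Word.isLoop_posSplit₂ hl.1.1 hne hsame) hrest hδ
        ((Word.length_posSplit₁_le l xy.1 xy.2).trans (by omega))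
        (Word.length_posSplit₂_le l hne)
    -- the two deformation sums
    have hB : ∀ (op : Fin l.length → ZdPlaquette d → Word d),
        (∀ (x : Fin l.length) (p : ZdPlaquette d), p ∈ plaquettesAt (l.get x) →
            IsLoop (op x p) ∧ (op x p).length ≤ l.length + 4) →
        ∑ p ∈ plaquettesAt e, ∑ x ∈ Word.locs l e, T φ ψ (LoopSeq.prune (op x p :: rest)) ≤
          ((2 * (d - 1) : ℕ) : ℝ≥0∞) * ((Word.occ l e : ℝ≥0∞) * X) := by
      intro op hop
      calc ∑ p ∈ plaquettesAt e, ∑ x ∈ Word.locs l e, T φ ψ (LoopSeq.prune (op x p :: rest))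
            ≤ ∑ p ∈ plaquettesAt e, ∑ x ∈ Word.locs l e, X := by
              refine Finset.sum_le_sum fun p hp => Finset.sum_le_sum fun x hx => ?_
              rw [← Word.plaquettesAt_eq_of_mem_locs hx] at hp
              obtain ⟨hloop, hlen⟩ := hop x p hp
              exact T_prune_one_le hloop hrest hδ (hlen.trans (by omega))
        _ = ((plaquettesAt e).card : ℝ≥0∞) * ((Word.occ l e : ℝ≥0∞) * X) := by
              rw [Finset.sum_const, Finset.sum_const, nsmul_eq_mul, nsmul_eq_mul, Word.occ]
        _ ≤ ((2 * (d - 1) : ℕ) : ℝ≥0∞) * ((Word.occ l e : ℝ≥0∞) * X) := by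
              gcongr
              exact_mod_cast card_plaquettesAt_le e
    have hB₁ := hB (fun x p => Word.negDeform l x p) fun x p hp =>
      ⟨Word.isLoop_negDeform hl.1.1 x hp, Word.length_negDeform_le l x p⟩
    have hB₂ := hB (fun x p => Word.posDeform l x p) fun x p hp =>
      ⟨Word.isLoop_posDeform hl.1.1 x hp, Word.length_posDeform_le l x p⟩
    -- assemble and cancel `m`
    have hmain := (occ_mul_T_le hφc hψc hs x₀).trans
      (add_le_add (add_le_add hS₁ hS₂) (mul_le_mul_right (add_le_add hB₁ hB₂) _))
    rw [← he] at hmain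
    have hrhs : (Word.occ l e : ℝ≥0∞) * ∑ k ∈ Finset.Ico 1 c, f k + (Word.occ l e : ℝ≥0∞) * ∑ k ∈ Finset.Ico 1 c, f k
        + ENNReal.ofReal |β| * (((2 * (d - 1) : ℕ) : ℝ≥0∞) * ((Word.occ l e : ℝ≥0∞) * X)
          + ((2 * (d - 1) : ℕ) : ℝ≥0∞) * ((Word.occ l e : ℝ≥0∞) * X)) =
        (Word.occ l e : ℝ≥0∞) * (2 * ∑ k ∈ Finset.Ico 1 c, f k
          + 2 * ((2 * (d - 1) : ℕ) : ℝ≥0∞) * ENNReal.ofReal |β| * X) := by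
      ring
    rw [hrhs] at hmain
    exact (ENNReal.mul_le_mul_iff_right hm0 (ENNReal.natCast_ne_top _)).mp hmain


/-! ### §H The contraction `F(λ) ≤ κ F(λ)` -/

section Contraction

variable (φ ψ) (t b : ℝ≥0∞) (P : ℕ)

/-- Index set of the splitting pieces at `δ = (c, …)`: gaps `k ∈ [1, c)` (only for `c ≥ 2`). [folklore] -/
def icoS : List ℕ → Finset ℕ
  | [] => ∅
  | c :: _ => if 2 ≤ c then Finset.Ico 1 c else ∅

/-- Index set of the unsummed pieces at `δ = (c, …)` (only for `c ≥ 2`). [folklore] -/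
def unitS : List ℕ → Finset Unit
  | [] => ∅
  | c :: _ => if 2 ≤ c then {()} else ∅

/-- Weighted piece `λ^ι 2 D(c−k, k, δ₂, …)` (θₖ). [cite: Chatterjee2019LargeN, §9, proof of Theorem 9.2 ((ff1))] -/
def F₁ : List ℕ → ℕ → ℝ≥0∞
  | [], _ => 0
  | c :: δr, k => w t (c :: δr) * (2 * D φ ψ ((c - k) :: k :: δr))

/-- Weighted piece `λ^ι 2 D(c−k, δ₂, …)` (first null-piece case). [cite: Chatterjee2019LargeN, §9, proof of Theorem 9.2 ((ff1)–(ff2))] -/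
def F₂ : List ℕ → ℕ → ℝ≥0∞
  | [], _ => 0
  | c :: δr, k => w t (c :: δr) * (2 * D φ ψ ((c - k) :: δr))

/-- Weighted piece `λ^ι 2 D(k, δ₂, …)` (second null-piece case). [cite: Chatterjee2019LargeN, §9, proof of Theorem 9.2 ((ff1)–(ff2))] -/
def F₃ : List ℕ → ℕ → ℝ≥0∞
  | [], _ => 0
  | c :: δr, k => w t (c :: δr) * (2 * D φ ψ (k :: δr))

/-- Weighted piece `λ^ι 2 (c−1) D(δ₂, …)` (both pieces null). [cite: Chatterjee2019LargeN, §9, proof of Theorem 9.2 ((ff5))] -/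
def F₄ : List ℕ → Unit → ℝ≥0∞
  | [], _ => 0
  | c :: δr, _ => w t (c :: δr) * (2 * (((c - 1 : ℕ) : ℝ≥0∞) * D φ ψ δr))

/-- Weighted piece `λ^ι 2P|β| D(c+4, δ₂, …)` (α). [cite: Chatterjee2019LargeN, §9, proof of Theorem 9.2 ((ff3))] -/
def F₅ : List ℕ → Unit → ℝ≥0∞
  | [], _ => 0
  | c :: δr, _ => w t (c :: δr) * (2 * (P : ℝ≥0∞) * b * D φ ψ ((c + 4) :: δr))

/-- Weighted piece `λ^ι 2P|β| D(δ₂, …)` (γ). [cite: Chatterjee2019LargeN, §9, proof of Theorem 9.2 ((ff5))] -/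
def F₆ : List ℕ → Unit → ℝ≥0∞
  | [], _ => 0
  | c :: δr, _ => w t (c :: δr) * (2 * (P : ℝ≥0∞) * b * D φ ψ δr)

variable {φ ψ t b P}

/-- The weighted recursive bound, term by term. [cite: Chatterjee2019LargeN, §9, proof of Theorem 9.2 (the display (ffmain) «F(λ) ≤ ∑_δ λ^{ι(δ)} (4∑ₖ D(θₖ(δ)) + ⋯)»)] -/
theorem w_mul_D_le {β : ℝ} (h0 : φ [] = ψ []) (hφc : SatisfiesMasterLoopEquation φ β)
    (hψc : SatisfiesMasterLoopEquation ψ β) (t : ℝ≥0∞) (δ : List ℕ) :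
    w t δ * D φ ψ δ ≤
      (∑ k ∈ icoS δ, F₁ φ ψ t δ k) + (∑ k ∈ icoS δ, F₂ φ ψ t δ k) + (∑ k ∈ icoS δ, F₃ φ ψ t δ k)
      + (∑ u ∈ unitS δ, F₄ φ ψ t δ u)
      + (∑ u ∈ unitS δ, F₅ φ ψ t (ENNReal.ofReal |β|) (2 * (d - 1)) δ u)
      + (∑ u ∈ unitS δ, F₆ φ ψ t (ENNReal.ofReal |β|) (2 * (d - 1)) δ u) := by
  cases δ with
  | nil => simp [D_nil h0]
  | cons c δr =>
    by_cases hc : 2 ≤ c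
    · calc w t (c :: δr) * D φ ψ (c :: δr) ≤ w t (c :: δr) * _ := mul_le_mul_right (D_cons_le hφc hψc c δr) _
        _ = _ := by
          simp only [icoS, unitS, F₁, F₂, F₃, F₄, F₅, F₆, if_pos hc, Finset.card_singleton, Nat.cast_one,
            Finset.sum_add_distrib, Finset.sum_const, Nat.card_Ico, nsmul_eq_mul, ← Finset.mul_sum]
          ring
    · rw [D_eq_zero_of_lt_two (List.mem_cons_self (a := c) (l := δr)) (by omega), mul_zero]
      exact bot_le

/-- `∑_δ ∑ₖ F₁ ≤ 2λ F(λ)` ((ff1): `θₖ` injective, `ι(θₖ δ) = ι(δ) − 1`). [cite: Chatterjee2019LargeN, §9, proof of Theorem 9.2 ((ff1))] -/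
theorem tsum_F₁_le (t : ℝ≥0∞) : ∑' δ, ∑ k ∈ icoS δ, F₁ φ ψ t δ k ≤ 2 * t * F φ ψ t := by
  rw [F, ← ENNReal.tsum_mul_left]
  refine tsum_sum_le_tsum_of_inj icoS _
    (fun δ k => match δ with | [] => [] | c :: δr => (c - k) :: k :: δr) _ ?_ ?_
  · rintro (_ | ⟨c, δr⟩) k hk
    · simp [icoS] at hk
    · simp only [icoS] at hk
      split_ifs at hk with hc
      · rw [Finset.mem_Ico] at hk
        simp only [F₁, w_cons]
        rw [show c - 1 = 1 + (c - k - 1) + (k - 1) by omega, pow_add, pow_add, pow_one]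
        exact le_of_eq (by ring)
      · simp at hk
  · rintro (_ | ⟨c, δr⟩) (_ | ⟨c', δr'⟩) k k' hk hk' h <;> simp only [icoS] at hk hk'
    · simp at hk
    · simp at hk
    · simp at hk'
    · split_ifs at hk hk'
      · rw [Finset.mem_Ico] at hk hk'
        simp only [List.cons.injEq] at h
        obtain ⟨h1, h2, h3⟩ := h
        refine ⟨?_, h2⟩
        rw [h3, show c = c' by omega]
      all_goals simp at hk hk'

/-- `∑_{(j, δ')} 2 λ^{j+1} λ^{ι(δ')} D(δ') = (∑ⱼ 2λ^{j+1}) F(λ)`. [folklore] -/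
private theorem tsum_prod_pow_succ (t : ℝ≥0∞) :
    ∑' p : ℕ × List ℕ, 2 * t ^ (p.1 + 1) * (w t p.2 * D φ ψ p.2) = (∑' j : ℕ, 2 * t ^ (j + 1)) * F φ ψ t := by
  rw [ENNReal.tsum_prod', F, ← ENNReal.tsum_mul_right]
  exact tsum_congr fun j => by dsimp only; exact ENNReal.tsum_mul_left

/-- `∑ⱼ 2λ^{j+1} ≤ 4λ` for `λ ≤ 1/2`. [folklore] -/
private theorem tsum_two_mul_pow_succ_le {t : ℝ≥0∞} (ht : t ≤ 2⁻¹) : ∑' j : ℕ, 2 * t ^ (j + 1) ≤ 4 * t := by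
  rw [ENNReal.tsum_mul_left]
  calc 2 * ∑' j : ℕ, t ^ (j + 1) ≤ 2 * (2 * t) := by gcongr; exact tsum_geometric_succ_le ht
    _ = 4 * t := by ring

/-- `∑_δ ∑ₖ F₂ ≤ 4λ F(λ)` (null second piece: the vector `(c−k, δ₂, …)` has index `ι(δ) − k`).
[cite: Chatterjee2019LargeN, §9, proof of Theorem 9.2 ((ff1)–(ff2))] -/
theorem tsum_F₂_le {t : ℝ≥0∞} (ht : t ≤ 2⁻¹) : ∑' δ, ∑ k ∈ icoS δ, F₂ φ ψ t δ k ≤ 4 * t * F φ ψ t := by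
  refine le_trans ?_ ((mul_le_mul_left (tsum_two_mul_pow_succ_le ht) _).trans_eq' (tsum_prod_pow_succ t).symm)
  refine tsum_sum_le_tsum_of_inj icoS _
    (fun δ k => match δ with | [] => (0, []) | c :: δr => (k - 1, (c - k) :: δr)) _ ?_ ?_
  · rintro (_ | ⟨c, δr⟩) k hk
    · simp [icoS] at hk
    · simp only [icoS] at hk
      split_ifs at hk with hc
      · rw [Finset.mem_Ico] at hk
        simp only [F₂, w_cons]
        rw [show c - 1 = (k - 1 + 1) + (c - k - 1) by omega, pow_add]
        exact le_of_eq (by ring)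
      · simp at hk
  · rintro (_ | ⟨c, δr⟩) (_ | ⟨c', δr'⟩) k k' hk hk' h <;> simp only [icoS] at hk hk'
    · simp at hk
    · simp at hk
    · simp at hk'
    · split_ifs at hk hk'
      · rw [Finset.mem_Ico] at hk hk'
        simp only [Prod.mk.injEq, List.cons.injEq] at h
        obtain ⟨h1, h2, h3⟩ := h
        have hk2 : k = k' := by omega
        refine ⟨?_, hk2⟩
        rw [h3, show c = c' by omega]
      all_goals simp at hk hk'

/-- `∑_δ ∑ₖ F₃ ≤ 4λ F(λ)` (null first piece: the vector `(k, δ₂, …)` has index `ι(δ) − (c − k)`).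
[cite: Chatterjee2019LargeN, §9, proof of Theorem 9.2 ((ff1)–(ff2))] -/
theorem tsum_F₃_le {t : ℝ≥0∞} (ht : t ≤ 2⁻¹) : ∑' δ, ∑ k ∈ icoS δ, F₃ φ ψ t δ k ≤ 4 * t * F φ ψ t := by
  refine le_trans ?_ ((mul_le_mul_left (tsum_two_mul_pow_succ_le ht) _).trans_eq' (tsum_prod_pow_succ t).symm)
  refine tsum_sum_le_tsum_of_inj icoS _
    (fun δ k => match δ with | [] => (0, []) | c :: δr => (c - k - 1, k :: δr)) _ ?_ ?_
  · rintro (_ | ⟨c, δr⟩) k hk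
    · simp [icoS] at hk
    · simp only [icoS] at hk
      split_ifs at hk with hc
      · rw [Finset.mem_Ico] at hk
        simp only [F₃, w_cons]
        rw [show c - 1 = (c - k - 1 + 1) + (k - 1) by omega, pow_add]
        exact le_of_eq (by ring)
      · simp at hk
  · rintro (_ | ⟨c, δr⟩) (_ | ⟨c', δr'⟩) k k' hk hk' h <;> simp only [icoS] at hk hk'
    · simp at hk
    · simp at hk
    · simp at hk'
    · split_ifs at hk hk'
      · rw [Finset.mem_Ico] at hk hk'
        simp only [Prod.mk.injEq, List.cons.injEq] at h
        obtain ⟨h1, h2, h3⟩ := h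
        refine ⟨?_, h2⟩
        rw [h3, show c = c' by omega]
      all_goals simp at hk hk'

/-- `∑_c 2 (c−1) λ^{c−1} ≤ 8λ` for `λ ≤ 1/4` (`j λʲ ≤ (2λ)ʲ`). [folklore] -/
private theorem tsum_sub_one_mul_pow_le {t : ℝ≥0∞} (ht : 2 * t ≤ 2⁻¹) :
    ∑' c : ℕ, 2 * (((c - 1 : ℕ) : ℝ≥0∞) * t ^ (c - 1)) ≤ 8 * t := by
  have hsupp : Function.support (fun c : ℕ => 2 * (((c - 1 : ℕ) : ℝ≥0∞) * t ^ (c - 1))) ⊆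
      Set.range fun i : ℕ => i + 2 := by
    intro c hc
    rw [Function.mem_support] at hc
    by_cases h2c : 2 ≤ c
    · exact ⟨c - 2, by simp [Nat.sub_add_cancel h2c]⟩
    · exfalso; apply hc
      have : c - 1 = 0 := by omega
      simp [this]
  have hinj : Function.Injective fun i : ℕ => i + 2 := fun a b h => by simpa using h
  rw [← hinj.tsum_eq hsupp]
  simp only [show ∀ i : ℕ, i + 2 - 1 = i + 1 from fun i => by omega]
  rw [ENNReal.tsum_mul_left]
  calc 2 * ∑' i : ℕ, (((i + 1 : ℕ) : ℝ≥0∞) * t ^ (i + 1)) ≤ 2 * ∑' i : ℕ, (2 * t) ^ (i + 1) := by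
        gcongr with i
        exact mul_pow_le_two_mul_pow t (i + 1)
    _ ≤ 2 * (2 * (2 * t)) := by gcongr; exact tsum_geometric_succ_le ht
    _ = 8 * t := by ring

/-- `∑_δ F₄ ≤ 8λ F(λ)` (both pieces null: `(c−1)` terms, index `ι(δ) − (c−1)`). [cite: Chatterjee2019LargeN, §9, proof of Theorem 9.2 ((ff5))] -/
theorem tsum_F₄_le {t : ℝ≥0∞} (ht : 2 * t ≤ 2⁻¹) : ∑' δ, ∑ u ∈ unitS δ, F₄ φ ψ t δ u ≤ 8 * t * F φ ψ t := by
  have hprod : ∑' p : ℕ × List ℕ, 2 * ((((p.1 - 1 : ℕ)) : ℝ≥0∞) * t ^ (p.1 - 1)) * (w t p.2 * D φ ψ p.2) =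
      (∑' c : ℕ, 2 * (((c - 1 : ℕ) : ℝ≥0∞) * t ^ (c - 1))) * F φ ψ t := by
    rw [ENNReal.tsum_prod', F, ← ENNReal.tsum_mul_right]
    exact tsum_congr fun j => by dsimp only; exact ENNReal.tsum_mul_left
  refine le_trans ?_ ((mul_le_mul_left (tsum_sub_one_mul_pow_le ht) _).trans_eq' hprod.symm)
  refine tsum_sum_le_tsum_of_inj unitS _
    (fun δ _ => match δ with | [] => (0, []) | c :: δr => (c, δr)) _ ?_ ?_
  · rintro (_ | ⟨c, δr⟩) u hu
    · simp [unitS] at hu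
    · simp only [F₄, w_cons]
      exact le_of_eq (by ring)
  · rintro (_ | ⟨c, δr⟩) (_ | ⟨c', δr'⟩) u u' hu hu' h <;> simp only [unitS] at hu hu'
    · simp at hu
    · simp at hu
    · simp at hu'
    · simp only [Prod.mk.injEq] at h
      obtain ⟨rfl, rfl⟩ := h
      exact ⟨rfl, Subsingleton.elim _ _⟩

/-- `∑_δ F₅ ≤ 2λ F(λ)` when `P|β| ≤ λ⁵` (α: index `ι(δ) + 4`; the printed `λ^{−4}` is absorbed into the smallness of `β`).
[cite: Chatterjee2019LargeN, §9, proof of Theorem 9.2 ((ff3))] -/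
theorem tsum_F₅_le {t b : ℝ≥0∞} {P : ℕ} (hb : (P : ℝ≥0∞) * b ≤ t ^ 5) :
    ∑' δ, ∑ u ∈ unitS δ, F₅ φ ψ t b P δ u ≤ 2 * t * F φ ψ t := by
  rw [F, ← ENNReal.tsum_mul_left]
  refine tsum_sum_le_tsum_of_inj unitS _
    (fun δ _ => match δ with | [] => [] | c :: δr => (c + 4) :: δr) _ ?_ ?_
  · rintro (_ | ⟨c, δr⟩) u hu
    · simp [unitS] at hu
    · simp only [unitS] at hu
      split_ifs at hu with hc
      · simp only [F₅, w_cons]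
        calc t ^ (c - 1) * w t δr * (2 * (P : ℝ≥0∞) * b * D φ ψ ((c + 4) :: δr))
              = 2 * ((P : ℝ≥0∞) * b) * t ^ (c - 1) * (w t δr * D φ ψ ((c + 4) :: δr)) := by ring
          _ ≤ 2 * t ^ 5 * t ^ (c - 1) * (w t δr * D φ ψ ((c + 4) :: δr)) := by gcongr
          _ = 2 * t * (t ^ (c + 4 - 1) * w t δr * D φ ψ ((c + 4) :: δr)) := by
              rw [show c + 4 - 1 = 4 + (c - 1) by omega, pow_add,
                show (5 : ℕ) = 1 + 4 by norm_num, pow_add, pow_one]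
              ring
      · simp at hu
  · rintro (_ | ⟨c, δr⟩) (_ | ⟨c', δr'⟩) u u' hu hu' h <;> simp only [unitS] at hu hu'
    · simp at hu
    · simp at hu
    · simp at hu'
    · simp only [List.cons.injEq] at h
      obtain ⟨h1, rfl⟩ := h
      exact ⟨by rw [show c = c' by omega], Subsingleton.elim _ _⟩

/-- `∑_c 𝟙[c ≥ 2] 2 λ^{c−1} ≤ 4λ` for `λ ≤ 1/2`. [folklore] -/
private theorem tsum_ite_pow_le {t : ℝ≥0∞} (ht : t ≤ 2⁻¹) :
    ∑' c : ℕ, (if 2 ≤ c then 2 * t ^ (c - 1) else 0) ≤ 4 * t := by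
  have hsupp : Function.support (fun c : ℕ => if 2 ≤ c then 2 * t ^ (c - 1) else (0 : ℝ≥0∞)) ⊆
      Set.range fun i : ℕ => i + 2 := by
    intro c hc
    rw [Function.mem_support] at hc
    by_cases h2c : 2 ≤ c
    · exact ⟨c - 2, by simp [Nat.sub_add_cancel h2c]⟩
    · exact absurd (if_neg h2c) hc
  have hinj : Function.Injective fun i : ℕ => i + 2 := fun a b h => by simpa using h
  rw [← hinj.tsum_eq hsupp]
  simp only [show ∀ i : ℕ, 2 ≤ i + 2 from fun i => by omega, if_true,
    show ∀ i : ℕ, i + 2 - 1 = i + 1 from fun i => by omega]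
  exact tsum_two_mul_pow_succ_le ht

/-- `∑_δ F₆ ≤ 4λ F(λ)` when `P|β| ≤ 1` (γ: index `ι(δ) − (c−1)`, `c ≥ 2`). [cite: Chatterjee2019LargeN, §9, proof of Theorem 9.2 ((ff5))] -/
theorem tsum_F₆_le {t b : ℝ≥0∞} {P : ℕ} (ht : t ≤ 2⁻¹) (hb : (P : ℝ≥0∞) * b ≤ 1) :
    ∑' δ, ∑ u ∈ unitS δ, F₆ φ ψ t b P δ u ≤ 4 * t * F φ ψ t := by
  have hprod : ∑' p : ℕ × List ℕ, (if 2 ≤ p.1 then 2 * t ^ (p.1 - 1) else 0) * (w t p.2 * D φ ψ p.2) =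
      (∑' c : ℕ, if 2 ≤ c then 2 * t ^ (c - 1) else 0) * F φ ψ t := by
    rw [ENNReal.tsum_prod', F, ← ENNReal.tsum_mul_right]
    refine tsum_congr fun j => ?_
    dsimp only
    exact ENNReal.tsum_mul_left (a := if 2 ≤ j then 2 * t ^ (j - 1) else 0) (f := fun δ => w t δ * D φ ψ δ)
  refine le_trans ?_ ((mul_le_mul_left (tsum_ite_pow_le ht) _).trans_eq' hprod.symm)
  refine tsum_sum_le_tsum_of_inj unitS _
    (fun δ _ => match δ with | [] => (0, []) | c :: δr => (c, δr)) _ ?_ ?_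
  · rintro (_ | ⟨c, δr⟩) u hu
    · simp [unitS] at hu
    · simp only [unitS] at hu
      split_ifs at hu with hc
      · simp only [F₆, w_cons, if_pos hc]
        calc t ^ (c - 1) * w t δr * (2 * (P : ℝ≥0∞) * b * D φ ψ δr)
              = ((P : ℝ≥0∞) * b) * (2 * t ^ (c - 1) * (w t δr * D φ ψ δr)) := by ring
          _ ≤ 1 * (2 * t ^ (c - 1) * (w t δr * D φ ψ δr)) := by gcongr
          _ = _ := one_mul _
      · simp at hu
  · rintro (_ | ⟨c, δr⟩) (_ | ⟨c', δr'⟩) u u' hu hu' h <;> simp only [unitS] at hu hu'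
    · simp at hu
    · simp at hu
    · simp at hu'
    · simp only [Prod.mk.injEq] at h
      obtain ⟨rfl, rfl⟩ := h
      exact ⟨rfl, Subsingleton.elim _ _⟩

/-- **The contraction** («Combining (ff1), (ff2), (ff3), (ff4) and (ff5), we get `F(λ) ≤ (4λ³ + 4λ + 4|β|d/λ⁴ + 4|β|d/(1−λ))
F(λ)`»; here with constants `F ≤ 24λ·F` for `λ ≤ 1/4` and `2(d−1)|β| ≤ λ⁵`).
[cite: Chatterjee2019LargeN, §9, proof of Theorem 9.2 (the contraction inequality for F(λ))] -/
theorem F_le_mul_F {β : ℝ} (h0 : φ [] = ψ []) (hφc : SatisfiesMasterLoopEquation φ β)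
    (hψc : SatisfiesMasterLoopEquation ψ β) {t : ℝ≥0∞} (ht : 2 * t ≤ 2⁻¹)
    (hb : ((2 * (d - 1) : ℕ) : ℝ≥0∞) * ENNReal.ofReal |β| ≤ t ^ 5) :
    F φ ψ t ≤ 24 * t * F φ ψ t := by
  have ht' : t ≤ 2⁻¹ := le_trans (by calc t = 1 * t := (one_mul t).symm
    _ ≤ 2 * t := by gcongr; norm_num) ht
  have ht1 : t ≤ 1 := ht'.trans (by norm_num)
  have hb1 : ((2 * (d - 1) : ℕ) : ℝ≥0∞) * ENNReal.ofReal |β| ≤ 1 :=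
    hb.trans (by calc t ^ 5 ≤ 1 ^ 5 := by gcongr
      _ = 1 := one_pow _)
  calc F φ ψ t = ∑' δ, w t δ * D φ ψ δ := rfl
    _ ≤ ∑' δ, ((∑ k ∈ icoS δ, F₁ φ ψ t δ k) + (∑ k ∈ icoS δ, F₂ φ ψ t δ k) + (∑ k ∈ icoS δ, F₃ φ ψ t δ k)
          + (∑ u ∈ unitS δ, F₄ φ ψ t δ u)
          + (∑ u ∈ unitS δ, F₅ φ ψ t (ENNReal.ofReal |β|) (2 * (d - 1)) δ u)
          + (∑ u ∈ unitS δ, F₆ φ ψ t (ENNReal.ofReal |β|) (2 * (d - 1)) δ u)) :=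
        ENNReal.tsum_le_tsum fun δ => w_mul_D_le h0 hφc hψc t δ
    _ = (∑' δ, ∑ k ∈ icoS δ, F₁ φ ψ t δ k) + (∑' δ, ∑ k ∈ icoS δ, F₂ φ ψ t δ k)
          + (∑' δ, ∑ k ∈ icoS δ, F₃ φ ψ t δ k) + (∑' δ, ∑ u ∈ unitS δ, F₄ φ ψ t δ u)
          + (∑' δ, ∑ u ∈ unitS δ, F₅ φ ψ t (ENNReal.ofReal |β|) (2 * (d - 1)) δ u)
          + (∑' δ, ∑ u ∈ unitS δ, F₆ φ ψ t (ENNReal.ofReal |β|) (2 * (d - 1)) δ u) := by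
        rw [ENNReal.tsum_add, ENNReal.tsum_add, ENNReal.tsum_add, ENNReal.tsum_add, ENNReal.tsum_add]
    _ ≤ 2 * t * F φ ψ t + 4 * t * F φ ψ t + 4 * t * F φ ψ t + 8 * t * F φ ψ t + 2 * t * F φ ψ t
          + 4 * t * F φ ψ t :=
        add_le_add (add_le_add (add_le_add (add_le_add (add_le_add (tsum_F₁_le t) (tsum_F₂_le ht'))
          (tsum_F₃_le ht')) (tsum_F₄_le ht)) (tsum_F₅_le hb)) (tsum_F₆_le ht' hb1)
    _ = 24 * t * F φ ψ t := by ring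

end Contraction


/-! ### §I Conclusion of the contraction argument -/

/-- In `ℝ≥0∞`: `a ≤ κ a` with `2κ ≤ 1` and `a` finite forces `a = 0`. [folklore] -/
private theorem eq_zero_of_le_mul_of_two_mul_le {a κ : ℝ≥0∞} (h : a ≤ κ * a) (hκ : 2 * κ ≤ 1) (ha : a ≠ ⊤) : a = 0 := by
  refine eq_zero_of_le_mul h (lt_of_le_of_lt ?_ (ENNReal.inv_lt_one.2 ENNReal.one_lt_two)) ha
  rw [ENNReal.le_inv_iff_mul_le, mul_comm]
  exact hκ

/-- `w_t(δ) ≠ 0` for `t ≠ 0`. [folklore] -/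
private theorem w_ne_zero {t : ℝ≥0∞} (ht : t ≠ 0) (δ : List ℕ) : w t δ ≠ 0 := by
  rw [w, Ne, List.prod_eq_zero_iff, List.mem_map]
  rintro ⟨c, -, hc⟩
  exact pow_ne_zero _ ht hc

/-- A canonical exhaustion of `ℤ^d` by the cubes `[−n, n]^d`. [cite: Chatterjee2019LargeN, §3 Thm. 3.1 («Λ_N … any sequence increasing to ℤ^d»)] -/
theorem exists_isExhaustion (d : ℕ) :
    ∃ Λ : ℕ → Finset (Literature.Probability.LatticeModels.Site d), IsExhaustion Λ := by
  refine ⟨fun n => Fintype.piFinset fun _ : Fin d => Finset.Icc (-(n : ℤ)) n, ?_, ?_⟩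
  · intro m n hmn x hx
    rw [Fintype.mem_piFinset] at hx ⊢
    intro i
    have h := hx i
    rw [Finset.mem_Icc] at h ⊢
    have hmn' : (m : ℤ) ≤ n := by exact_mod_cast hmn
    constructor <;> linarith [h.1, h.2]
  · intro x
    refine ⟨∑ i, (x i).natAbs, ?_⟩
    rw [Fintype.mem_piFinset]
    intro i
    rw [Finset.mem_Icc]
    have h1 : ((x i).natAbs : ℤ) ≤ ((∑ j, (x j).natAbs : ℕ) : ℤ) := by
      exact_mod_cast Finset.single_le_sum (fun j _ => Nat.zero_le (x j).natAbs) (Finset.mem_univ i)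
    rw [Int.natCast_natAbs] at h1
    constructor <;> linarith [neg_abs_le (x i), le_abs_self (x i)]

end MasterLoopUniquenessProof

open MasterLoopUniquenessProof in
/-- ★ **Theorem 9.2 of Chatterjee (2019), uniqueness clause — PROVED, hypothesis-free.** «Given any `L ≥ 1`, there exists
`β₀(L,d) > 0` such that if `|β| ≤ β₀(L,d)`, then there is a unique function `φ_β : 𝒮 → ℝ` such that (a) `φ_β(∅) = 1`,
(b) `|φ_β(s)| ≤ L^{|s|}` for all `s`, and (c) `φ_β` satisfies the master loop equation of Theorem 9.1»: any two members
of the solution class `IsMasterLoopSolution L β` agree on every loop sequence.  Here `β₀ = ((48⌈L⌉²)⁵ (2(d−1)+1))⁻¹`.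
Proof = the printed contraction argument for `F(λ) = ∑_δ λ^{ι(δ)} D(δ)` (§9, pp. 1035–1037), see the module docstring.
[cite: Chatterjee2019LargeN, Theorem 9.2 (uniqueness of φ_β)] -/
theorem masterLoopSolution_unique {L : ℝ} (hL : 1 ≤ L) :
    ∃ β₀ : ℝ, 0 < β₀ ∧ ∀ β : ℝ, |β| ≤ β₀ → ∀ φ ψ : LoopSeq d → ℝ,
      IsMasterLoopSolution L β φ → IsMasterLoopSolution L β ψ → ∀ s : LoopSeq d, IsLoopSeq s → φ s = ψ s := by
  -- the constants
  set M : ℕ := ⌈L⌉₊ with hM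
  have hLM : L ≤ M := Nat.le_ceil L
  have hM1 : 1 ≤ M := Nat.one_le_iff_ne_zero.mpr (by
    intro h; rw [h, Nat.cast_zero] at hLM; linarith)
  set N : ℕ := 48 * M ^ 2 with hN
  have hN48 : 48 ≤ N := by nlinarith
  set P : ℕ := 2 * (d - 1) with hP
  set t : ℝ≥0∞ := (N : ℝ≥0∞)⁻¹ with ht
  have hN0 : (N : ℝ≥0∞) ≠ 0 := by exact_mod_cast (show N ≠ 0 by omega)
  have hNT : (N : ℝ≥0∞) ≠ ⊤ := ENNReal.natCast_ne_top N
  have ht0 : t ≠ 0 := ENNReal.inv_ne_zero.mpr hNT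
  -- `k / N ≤ 1` for `k ≤ N`
  have hdiv : ∀ k : ℕ, k ≤ N → (k : ℝ≥0∞) * t ≤ 1 := by
    intro k hk
    rw [ht, ← div_eq_mul_inv, ENNReal.div_le_iff hN0 hNT, one_mul]
    exact_mod_cast hk
  have h2t : 2 * t ≤ 2⁻¹ := by
    rw [ENNReal.le_inv_iff_mul_le]
    calc 2 * t * 2 = ((4 : ℕ) : ℝ≥0∞) * t := by push_cast; ring
      _ ≤ 1 := hdiv 4 (by omega)
  have h4tM : 4 * t * (M : ℝ≥0∞) ^ 2 ≤ 1 := by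
    calc 4 * t * (M : ℝ≥0∞) ^ 2 = ((4 * M ^ 2 : ℕ) : ℝ≥0∞) * t := by push_cast; ring
      _ ≤ 1 := hdiv _ (by omega)
  have h48t : 2 * (24 * t) ≤ 1 := by
    calc 2 * (24 * t) = ((48 : ℕ) : ℝ≥0∞) * t := by push_cast; ring
      _ ≤ 1 := hdiv 48 hN48
  -- `β₀`
  refine ⟨(((N : ℝ) ^ 5 * (P + 1)))⁻¹, by positivity, fun β hβ φ ψ hφ hψ s hs => ?_⟩
  obtain ⟨-, hφ0, hφb, hφc⟩ := hφ
  obtain ⟨-, hψ0, hψb, hψc⟩ := hψ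
  -- smallness of `β` in `ℝ≥0∞`: `P |β| ≤ t⁵`
  have hb : (P : ℝ≥0∞) * ENNReal.ofReal |β| ≤ t ^ 5 := by
    have h1 : ENNReal.ofReal |β| ≤ (((N ^ 5 * (P + 1) : ℕ)) : ℝ≥0∞)⁻¹ := by
      refine (ENNReal.ofReal_le_ofReal hβ).trans_eq ?_
      rw [ENNReal.ofReal_inv_of_pos (by positivity), ← ENNReal.ofReal_natCast]
      push_cast
      rfl
    have hA0 : ((N ^ 5 : ℕ) : ℝ≥0∞) ≠ 0 := by exact_mod_cast pow_ne_zero 5 (show N ≠ 0 by omega)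
    have hAT : ((N ^ 5 : ℕ) : ℝ≥0∞) ≠ ⊤ := ENNReal.natCast_ne_top _
    have hP1 : ((P + 1 : ℕ) : ℝ≥0∞) ≠ 0 := by exact_mod_cast Nat.succ_ne_zero P
    calc (P : ℝ≥0∞) * ENNReal.ofReal |β| ≤ (P : ℝ≥0∞) * (((N ^ 5 * (P + 1) : ℕ)) : ℝ≥0∞)⁻¹ := by gcongr
      _ = (P : ℝ≥0∞) / ((P + 1 : ℕ) : ℝ≥0∞) * (((N ^ 5 : ℕ) : ℝ≥0∞))⁻¹ := by
          rw [Nat.cast_mul (N ^ 5) (P + 1), ENNReal.mul_inv (Or.inl hA0) (Or.inl hAT), div_eq_mul_inv]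
          ring
      _ ≤ 1 * (((N ^ 5 : ℕ) : ℝ≥0∞))⁻¹ := by
          gcongr
          rw [ENNReal.div_le_iff hP1 (ENNReal.natCast_ne_top _), one_mul]
          exact_mod_cast Nat.le_succ P
      _ = t ^ 5 := by rw [one_mul, ht, ← ENNReal.inv_pow, Nat.cast_pow]
  -- the contraction
  have h0 : φ [] = ψ [] := by rw [hφ0, hψ0]
  have hF : F φ ψ t = 0 :=
    eq_zero_of_le_mul_of_two_mul_le (F_le_mul_F h0 hφc hψc h2t hb) h48t
      (F_lt_top hL hφb hψb hLM h4tM).ne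
  -- read off `T(s) = 0`
  have hD : D φ ψ (degree s) = 0 := by
    have h1 : w t (degree s) * D φ ψ (degree s) ≤ F φ ψ t := ENNReal.le_tsum (degree s)
    rw [hF, nonpos_iff_eq_zero, mul_eq_zero] at h1
    exact h1.resolve_left (w_ne_zero ht0 _)
  have hT : T φ ψ s = 0 :=
    le_antisymm ((T_le_D hs (List.forall₂_same.2 fun _ _ => le_rfl)).trans_eq hD) bot_le
  rw [T, ENNReal.ofReal_eq_zero] at hT
  have : |φ s - ψ s| = 0 := le_antisymm hT (abs_nonneg _)
  rw [abs_eq_zero, sub_eq_zero] at this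
  exact this

/-- **The named fact `MasterLoopUniqueness` (Theorem 9.2, first sentence) from Theorems 3.1 and 8.1**: existence by the
trajectory sum (`exists_masterLoopSolution`), uniqueness PROVED (`masterLoopSolution_unique`).
[cite: Chatterjee2019LargeN, Theorem 9.2 (first sentence), Theorem 3.1, Theorem 8.1] -/
theorem masterLoopUniqueness_of_gaugeStringDuality_of_unsymmetrized (hG : GaugeStringDuality d)
    (hU : UnsymmetrizedMasterLoopEquation d) : MasterLoopUniqueness d := by
  intro hd L hL
  obtain ⟨Λ, hΛ⟩ := MasterLoopUniquenessProof.exists_isExhaustion d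
  obtain ⟨β₁, hβ₁, H1⟩ := exists_masterLoopSolution hG hU hd hΛ
  obtain ⟨β₂, hβ₂, H2⟩ := masterLoopSolution_unique (d := d) hL
  exact ⟨min β₁ β₂, lt_min hβ₁ hβ₂, fun β hβ =>
    ⟨H1 L hL β (hβ.trans (min_le_left _ _)), fun φ φ' h h' => H2 β (hβ.trans (min_le_right _ _)) φ φ' h h'⟩⟩

/-- **Theorem 9.2, second part (existence of the 't Hooft limit) from Theorem 8.1 ALONE**: for `|β| ≤ β₀(1, d)` and
every exhaustion `Λ_N ↑ ℤ^d`, `φ_{Λ_N,N,β}(s)` converges as `N → ∞` for every loop sequence `s` — all subsequential limits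
(which exist, `exists_thooft_sublimit`, and are solutions of class `L = 1` by Theorem 9.1 ⇐ Theorem 8.1,
`isMasterLoopSolution_of_sublimit`) coincide by the proved uniqueness.  Supersedes
`thooftLimit_of_unsymmetrized_of_uniqueness` (whose uniqueness hypothesis is now a theorem).
[cite: Chatterjee2019LargeN, Theorem 9.2 («Consequently, … φ_{Λ_N,N,β}(s) converges to a limit φ_β(s) as N → ∞»)] -/
theorem thooftLimit_of_unsymmetrized (hU : UnsymmetrizedMasterLoopEquation d) : THooftLimit d := by
  intro hd
  obtain ⟨β₀, hβ₀, H⟩ := masterLoopSolution_unique (d := d) (L := 1) le_rfl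
  refine ⟨β₀, hβ₀, fun Λ hΛ β hβ s hs => ?_⟩
  obtain ⟨ν₁, hν₁, φ₁, hφ₁⟩ := exists_thooft_sublimit β Λ tendsto_id
  have hsol₁ := isMasterLoopSolution_of_sublimit hU hd hΛ β hν₁ hφ₁
  refine ⟨φ₁ s, tendsto_of_subseq_tendsto fun ns hns => ?_⟩
  obtain ⟨ms, hν₂, φ₂, hφ₂⟩ := exists_thooft_sublimit β Λ hns
  have hsol₂ := isMasterLoopSolution_of_sublimit hU hd hΛ β hν₂ hφ₂
  refine ⟨ms, ?_⟩
  rw [← H β hβ φ₂ φ₁ hsol₂ hsol₁ s hs]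
  exact hφ₂ s

/-- **The named fact `MasterLoopUniqueness` (Theorem 9.2, first sentence) from Theorem 8.1 ALONE** (v1.1): for
`L ≥ 1` and `|β| ≤ β₀(L, d)` (the constant of `masterLoopSolution_unique`), a solution of class `L` EXISTS — any
subsequential 't Hooft limit along any exhaustion (`exists_thooft_sublimit`; it is of class `1 ≤ L` by Theorem 9.1 ⇐
Theorem 8.1, `isMasterLoopSolution_of_sublimit`), exactly as in the printed proof («subsequential limits satisfy (a), (b),
(c)») — and it is unique on genuine loop sequences (`masterLoopSolution_unique`).  Supersedes
`masterLoopUniqueness_of_gaugeStringDuality_of_unsymmetrized`, whose Theorem 3.1 hypothesis only served existence.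
[cite: Chatterjee2019LargeN, Theorem 9.2 (first sentence) and the paragraph before Theorem 9.2; Theorem 8.1] -/
theorem masterLoopUniqueness_of_unsymmetrized (hU : UnsymmetrizedMasterLoopEquation d) : MasterLoopUniqueness d := by
  intro hd L hL
  obtain ⟨β₀, hβ₀, H⟩ := masterLoopSolution_unique (d := d) hL
  obtain ⟨Λ, hΛ⟩ := MasterLoopUniquenessProof.exists_isExhaustion d
  refine ⟨β₀, hβ₀, fun β hβ => ⟨?_, fun φ φ' h h' => H β hβ φ φ' h h'⟩⟩
  obtain ⟨ν, hν, φ, hφ⟩ := exists_thooft_sublimit β Λ tendsto_id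
  obtain ⟨hc, h0, hb, he⟩ := isMasterLoopSolution_of_sublimit hU hd hΛ β hν hφ
  exact ⟨φ, hc, h0, fun s hs => (hb s hs).trans (by rw [one_pow]; exact one_le_pow₀ hL), he⟩

end Literature.MathematicalPhysics.QuantumFieldTheory.Chatterjee2019LargeN

end
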